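import Summits.QuantumFields.YangMills.Theorems.FluctuationComparisonRegPrIntLS2BetaChartContCarrierNhds
import Summits.QuantumFields.YangMills.Theorems.FluctuationComparisonRegPrIntLWregDescendChart
import HarnessLib

/-!
# CHART∞ · V-c1 (LINE g18-1 `semiclassical_s2beta`, organ S2β, LAPLACE row): the `descendTo` chart WITH THE CLOSED-PROFILE JACOBIAN and its carrier rows

Cell `ym3-torus` (rung R3: continuum `SU(2)` Yang–Mills on `T³` — NOT `d = 4`, NOT infinite volume, NOT a mass gap, NOT Clay); width seat `ym-ust-20520-w3` g14;
helper of the crux `stmt-QuantumFields-20520` (`--supports`, NOT a proof of it).  THEOREMS ONLY (0 `def`, default heartbeats).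
✓F5 `exists_chartData_descendTo_reg` transports a generic fibred chart `(Φ, Jac, T)` of `Ū⁽ᴷ⁻ᴶ⁾` to `descendTo F 𝓔 J K` with the Jacobian `1[Φ ∈ Sfine] · Jac` (indicator
of the OPEN event — the source of the unsatisfiable `ha` row, w3-20520 g13 ‼ 18:02Z).  ★★★ `exists_chartData_descendTo_carrier` re-runs the transport ABSTRACTLY
(generic conjuncts as hypotheses) with a measurable companion `Sfine ⊆ Hc ⊆` chart-window set, `Hc` CLOSED, gauge invariant, with strict small loop history, and
**`jac♭ := 1[Φ ∈ Hc] · Jac`**: F5's thirteen conjuncts (`Hc` in `mem_of_ne_zero` ∕ `ne_zero_iff` ∕ `continuousAt_of_interior` ∕ `recog`; `map_Φ` FOR `Sfine` under the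
null row «`∀ V ∈ O`, a.e. `z`, `jac♭ ≠ 0 → Φ ∈ Sfine`», ✓`fibredLaw_transport` + `withDensity_congr_ae` + `Measure.ae_prod_iff_ae_ae`), PLUS (14) `IsCompact {jac♭ (V,·) ≠ 0}`
(✓V-a), (15) `ContinuousOn` of `Φ (V,·)`, `jac♭ (V,·)` there, (16)–(18) pivot blindness, (19) fibre points of `Hc` self-charted and live, (20) covariance under every
fine gauge transformation acting trivially on the coarse lattice (✓V-b1 ∕ ✓V-b2 as hypotheses), (21) the carrier over `V` is a NEIGHBOURHOOD of every fibre point of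
`V` in the open event (✓V-e1 as hypothesis).  HONEST SCOPE: transport∕bookkeeping; LAPLACE ∕ S2β ∕ crux 20520 NOT proved; `YM3TorusSU2` NOT proved; the Yang–Mills
mass gap (Clay) NOT proved.  [cite: Balaban1987RG1, (0.4)/(0.11) p.253, (2.4) p.266 and (2.10) p.267]
-/

noncomputable section

open MeasureTheory Filter Topology Set
open scoped ENNReal NNReal
open Literature.MathematicalPhysics.QuantumFieldTheory.Balaban1983to89
open Literature.MathematicalPhysics.QuantumFieldTheory.Balaban1983to89.T3ContinuumYM3Torus
open Literature.MathematicalPhysics.QuantumFieldTheory.Balaban1983to89.T3LevelShift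
open Literature.MathematicalPhysics.QuantumFieldTheory.Balaban1983to89.T3TiltDescent
open Literature.MathematicalPhysics.QuantumFieldTheory.Balaban1983to89.T4Continuum

namespace Summit.QuantumFields.YangMills.Theorems.FluctuationComparisonRegPrIntLS2BetaChartContDescend

open Summit.QuantumFields.YangMills.Theorems.FluctuationComparisonRegPrIntLWregChain
open Summit.QuantumFields.YangMills.Theorems.FluctuationComparisonRegPrIntLWregFibredChart
open Summit.QuantumFields.YangMills.Theorems.FluctuationComparisonRegPrIntLS2BetaChartContCarrier
open Function
open Literature.MathematicalPhysics.QuantumFieldTheory.Balaban1983to89.BlockAveraging (Idx loopHol measurable_avgFun)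
open Literature.MathematicalPhysics.QuantumFieldTheory.Balaban1983to89.ExpMeanLog (expMeanLogSU deltaSU measurable_expMeanLogSU_E)
open Literature.MathematicalPhysics.QuantumFieldTheory.Balaban1983to89.Node00 (SU)

variable {N : ℕ} [NeZero N]

/-- ★★★ **THE `descendTo` CHART WITH THE CLOSED-PROFILE JACOBIAN, AND ITS CARRIER ROWS** (abstract over the generic chart `(Φ, Jac, T)` of `Ū⁽ᴷ⁻ᴶ⁾`; see the
module docstring for the list of conjuncts). [cite: Balaban1987RG1, (0.4)/(0.11) p.253, (2.4) p.266 and (2.10) p.267] -/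
theorem exists_chartData_descendTo_carrier (F : T3Family) {J K : ℕ} (hJK : J ≤ K) {α : ℝ} (hαδ : α < deltaSU (Fin N))
    {Φ : GaugeField (F.P K) (K - J) (SU N) × GaugeField (F.P K) 0 (SU N) → GaugeField (F.P K) 0 (SU N)}
    {Jac : GaugeField (F.P K) (K - J) (SU N) × GaugeField (F.P K) 0 (SU N) → ℝ≥0}
    {T : PBond (F.P K) (K - J) → GaugeField (F.P K) 0 (SU N) → Set (SU N)}
    (hΦ : Measurable Φ) (hJac : Measurable Jac)
    (hfib : ∀ V z, Jac (V, z) ≠ 0 →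
      Averaging.iter (fun i => BlockAveraging.blockAvg (P := F.P K) (j := i) (expMeanLogSU (n := Fin N))) (K - J) (Φ (V, z)) = V)
    (hlaw : ∀ U₀ : Set (GaugeField (F.P K) (K - J) (SU N)), MeasurableSet U₀ →
      (fieldMeasure (F.P K) 0 (SU N)).restrict
          (Averaging.iter (fun i => BlockAveraging.blockAvg (P := F.P K) (j := i) (expMeanLogSU (n := Fin N))) (K - J) ⁻¹' U₀ ∩
            {U | ∀ c, U (iterCentralBond (K - J) c) ∈ chainWindow (N := N) α (K - J) U c}) =
        ((((fieldMeasure (F.P K) (K - J) (SU N)).restrict U₀).prod (fieldMeasure (F.P K) 0 (SU N))).withDensity fun p => (Jac p : ℝ≥0∞)).map Φ)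
    (hTc : ∀ c z, IsClosed (T c z))
    (hJT : ∀ V z, Jac (V, z) ≠ 0 ↔ ∀ c, V c ∈ T c z)
    (hreg : ∀ V₀ z, (∀ c, V₀ c ∈ interior (T c z)) → ContinuousAt (fun V => Φ (V, z)) V₀ ∧ ContinuousAt (fun V => Jac (V, z)) V₀)
    (hdead : ∀ V₀ z, (∃ c, V₀ c ∉ closure (T c z)) → ∀ᶠ V in 𝓝 V₀, Jac (V, z) = 0)
    (hTeq : ∀ c z, T c z = chainMap (expMeanLogSU (n := Fin N)) (K - J) z c '' chainWindow (N := N) α (K - J) z c)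
    (hcharted : ∀ V z, (∀ c, V c ∈ T c z) → (∀ b, (∀ c, iterCentralBond (K - J) c ≠ b) → Φ (V, z) b = z b) ∧
        ∀ c, Φ (V, z) (iterCentralBond (K - J) c) ∈ chainWindow (N := N) α (K - J) (Φ (V, z)) c)
    {j₀ : ℝ≥0} (hbdd : ∀ p, j₀ ^ ((K - J) * Fintype.card (PBond (F.P K) (K - J))) * Jac p ≤ 1)
    (hrecog : ∀ V z (g : PBond (F.P K) (K - J) → SU N), (∀ c, g c ∈ chainWindow (N := N) α (K - J) z c) →
        (∀ c, V c = Averaging.iter (fun i => BlockAveraging.blockAvg (P := F.P K) (j := i) (expMeanLogSU (n := Fin N))) (K - J)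
          (extend (iterCentralBond (K - J)) g z) c) →
        Jac (V, z) ≠ 0 ∧ Φ (V, z) = extend (iterCentralBond (K - J)) g z)
    (htransfer : ∀ (V : GaugeField (F.P K) (K - J) (SU N)) (z₀ : GaugeField (F.P K) 0 (SU N)), (∀ c, V c ∈ T c z₀) →
        (∀ k, k < K - J → ∀ (c' : PBond (F.P K) (k + 1)) (i : Idx (F.P K)),
          dist1 (loopHol (Averaging.iter (fun i => BlockAveraging.blockAvg (P := F.P K) (j := i) (expMeanLogSU (n := Fin N))) k (Φ (V, z₀))) c' i) < α) →
        ContinuousWithinAt Φ {p : GaugeField (F.P K) (K - J) (SU N) × GaugeField (F.P K) 0 (SU N) | ∀ c, p.1 c ∈ T c p.2} (V, z₀) ∧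
        ContinuousWithinAt Jac {p : GaugeField (F.P K) (K - J) (SU N) × GaugeField (F.P K) 0 (SU N) | ∀ c, p.1 c ∈ T c p.2} (V, z₀))
    (hTbl : ∀ c z (g : PBond (F.P K) (K - J) → SU N), T c (extend (iterCentralBond (K - J)) g z) = T c z)
    (hΦbl : ∀ V z (g : PBond (F.P K) (K - J) → SU N), (∀ c, V c ∈ T c z) → Φ (V, extend (iterCentralBond (K - J)) g z) = Φ (V, z))
    (hJbl : ∀ V z (g : PBond (F.P K) (K - J) → SU N), Jac (V, extend (iterCentralBond (K - J)) g z) = Jac (V, z))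
    (hcovΦ : ∀ (u : GaugeTransf (F.P K) 0 (SU N)) V z, Jac (V, z) ≠ 0 →
      Jac (GaugeField.gaugeAct (transfUp u (K - J)) V, GaugeField.gaugeAct u z) ≠ 0 ∧
        Φ (GaugeField.gaugeAct (transfUp u (K - J)) V, GaugeField.gaugeAct u z) = GaugeField.gaugeAct u (Φ (V, z)))
    (hcovJ : ∀ (u : GaugeTransf (F.P K) 0 (SU N)) V z, Jac (V, z) ≠ 0 →
      (∀ k, k < K - J → ∀ (c' : PBond (F.P K) (k + 1)) (i : Idx (F.P K)),
        dist1 (loopHol (Averaging.iter (fun i => BlockAveraging.blockAvg (P := F.P K) (j := i) (expMeanLogSU (n := Fin N))) k (Φ (V, z))) c' i) < α) →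
      Jac (GaugeField.gaugeAct (transfUp u (K - J)) V, GaugeField.gaugeAct u z) = Jac (V, z))
    (hgraph : ∀ U₀ : GaugeField (F.P K) 0 (SU N),
      (∀ k, k < K - J → ∀ (c' : PBond (F.P K) (k + 1)) (i : Idx (F.P K)),
        dist1 (loopHol (Averaging.iter (fun i => BlockAveraging.blockAvg (P := F.P K) (j := i) (expMeanLogSU (n := Fin N))) k U₀) c' i) < α) →
      {z : GaugeField (F.P K) 0 (SU N) | ∀ c,
        Averaging.iter (fun i => BlockAveraging.blockAvg (P := F.P K) (j := i) (expMeanLogSU (n := Fin N))) (K - J) U₀ c ∈ T c z} ∈ 𝓝 U₀)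
    {Sfine Hc : Set (GaugeField (F.P K) 0 (SU N))} (hSm : MeasurableSet Sfine) (hHm : MeasurableSet Hc) (hSH : Sfine ⊆ Hc)
    (hHsub : Hc ⊆ {U | ∀ c, U (iterCentralBond (K - J) c) ∈ chainWindow (N := N) α (K - J) U c})
    (hHcl : IsClosed Hc)
    (hHlt : Hc ⊆ {U | ∀ k, k < K - J → ∀ (c' : PBond (F.P K) (k + 1)) (i : Idx (F.P K)),
        dist1 (loopHol (Averaging.iter (fun i => BlockAveraging.blockAvg (P := F.P K) (j := i) (expMeanLogSU (n := Fin N))) k U) c' i) < α})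
    (hHg : ∀ (u : GaugeTransf (F.P K) 0 (SU N)) U, GaugeField.gaugeAct u U ∈ Hc ↔ U ∈ Hc) (hSo : IsOpen Sfine) :
    ∃ (Φ' : GaugeField (F.P J) 0 (SU N) × GaugeField (F.P K) 0 (SU N) → GaugeField (F.P K) 0 (SU N))
      (jac : GaugeField (F.P J) 0 (SU N) × GaugeField (F.P K) 0 (SU N) → ℝ≥0)
      (w : PBond (F.P K) (K - J) → PBond (F.P J) 0),
      Measurable Φ' ∧ Measurable jac ∧
      (∀ V z, jac (V, z) ≠ 0 → descendTo F (expMeanLogSU (n := Fin N)) J K hJK (Φ' (V, z)) = V) ∧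
      (∀ V z, jac (V, z) ≠ 0 → Φ' (V, z) ∈ Hc) ∧
      (∀ O : Set (GaugeField (F.P J) 0 (SU N)), MeasurableSet O →
        (∀ V ∈ O, ∀ᵐ z ∂fieldMeasure (F.P K) 0 (SU N), jac (V, z) ≠ 0 → Φ' (V, z) ∈ Sfine) →
        (fieldMeasure (F.P K) 0 (SU N)).restrict (descendTo F (expMeanLogSU (n := Fin N)) J K hJK ⁻¹' O ∩ Sfine) =
          ((((fieldMeasure (F.P J) 0 (SU N)).restrict O).prod (fieldMeasure (F.P K) 0 (SU N))).withDensity fun p => (jac p : ℝ≥0∞)).map Φ') ∧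
      (∀ c z, IsClosed (T c z)) ∧
      (∀ V z, jac (V, z) ≠ 0 ↔ (∀ c, V (w c) ∈ T c z) ∧ Φ' (V, z) ∈ Hc) ∧
      (∀ V₀ z, (∀ c, V₀ (w c) ∈ interior (T c z)) → Φ' (V₀, z) ∉ frontier Hc →
        ContinuousAt (fun V => Φ' (V, z)) V₀ ∧ ContinuousAt (fun V => jac (V, z)) V₀) ∧
      (∀ V₀ z, (∃ c, V₀ (w c) ∉ closure (T c z)) → ∀ᶠ V in 𝓝 V₀, jac (V, z) = 0) ∧
      (∀ c z, T c z = chainMap (expMeanLogSU (n := Fin N)) (K - J) z c '' chainWindow (N := N) α (K - J) z c) ∧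
      (∀ V z, (∀ c, V (w c) ∈ T c z) → (∀ b, (∀ c, iterCentralBond (K - J) c ≠ b) → Φ' (V, z) b = z b) ∧
        (∀ c, Φ' (V, z) (iterCentralBond (K - J) c) ∈ chainWindow (N := N) α (K - J) (Φ' (V, z)) c) ∧
        descendTo F (expMeanLogSU (n := Fin N)) J K hJK (Φ' (V, z)) = V) ∧
      (∀ p, j₀ ^ ((K - J) * Fintype.card (PBond (F.P K) (K - J))) * jac p ≤ 1) ∧
      (∀ V z (g : PBond (F.P K) (K - J) → SU N), (∀ c, g c ∈ chainWindow (N := N) α (K - J) z c) →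
        extend (iterCentralBond (K - J)) g z ∈ Hc →
        descendTo F (expMeanLogSU (n := Fin N)) J K hJK (extend (iterCentralBond (K - J)) g z) = V →
        jac (V, z) ≠ 0 ∧ Φ' (V, z) = extend (iterCentralBond (K - J)) g z) ∧
      (∀ V, IsCompact {z | jac (V, z) ≠ 0}) ∧
      (∀ V, ContinuousOn (fun z => Φ' (V, z)) {z | jac (V, z) ≠ 0} ∧ ContinuousOn (fun z => jac (V, z)) {z | jac (V, z) ≠ 0}) ∧
      (∀ c z (g : PBond (F.P K) (K - J) → SU N), T c (extend (iterCentralBond (K - J)) g z) = T c z) ∧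
      (∀ V z (g : PBond (F.P K) (K - J) → SU N), jac (V, extend (iterCentralBond (K - J)) g z) = jac (V, z)) ∧
      (∀ V z (g : PBond (F.P K) (K - J) → SU N), jac (V, z) ≠ 0 → Φ' (V, extend (iterCentralBond (K - J)) g z) = Φ' (V, z)) ∧
      (∀ V U, descendTo F (expMeanLogSU (n := Fin N)) J K hJK U = V → U ∈ Hc → jac (V, U) ≠ 0 ∧ Φ' (V, U) = U) ∧
      (∀ (u : GaugeTransf (F.P K) 0 (SU N)), (∀ V' : GaugeField (F.P K) (K - J) (SU N), GaugeField.gaugeAct (transfUp u (K - J)) V' = V') →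
        ∀ V z, jac (V, GaugeField.gaugeAct u z) = jac (V, z) ∧
          (jac (V, z) ≠ 0 → Φ' (V, GaugeField.gaugeAct u z) = GaugeField.gaugeAct u (Φ' (V, z)))) ∧
      (∀ V U, descendTo F (expMeanLogSU (n := Fin N)) J K hJK U = V → U ∈ Sfine → {z | jac (V, z) ≠ 0} ∈ 𝓝 U) := by
  haveI : IsProbabilityMeasure (HaarData.haar (G := SU N)) := HaarData.isProb
  have hn : K - J ≤ (F.P K).m + (F.P K).K := by show K - J ≤ F.m + K; omega
  have hβ := iterCentralBond_injective (P := F.P K) (n := K - J) hn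
  have hs := F.sitesPerDir_eq (m := F.m) (K := J) (j := 0) (m' := F.m) (K' := K) (j' := K - J) (by omega)
  set e : GaugeField (F.P K) (K - J) (SU N) → GaugeField (F.P J) 0 (SU N) := fieldShift hs with he_def
  set e' : GaugeField (F.P J) 0 (SU N) → GaugeField (F.P K) (K - J) (SU N) := fieldShift hs.symm with he'_def
  have he : Measurable e := measurable_fieldShift hs
  have he' : Measurable e' := measurable_fieldShift hs.symm
  have he'c : Continuous e' := continuous_pi fun c => continuous_apply (bondShift hs.symm c)
  have hee' : ∀ y', e (e' y') = y' := fieldShift_symm_fieldShift hs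
  have he'e : ∀ y, e' (e y) = y := fieldShift_fieldShift_symm hs
  have hpres : (fieldMeasure (F.P K) (K - J) (SU N)).map e = fieldMeasure (F.P J) 0 (SU N) := (measurePreserving_fieldShift hs).map_eq
  have hdesc : (descendTo F (expMeanLogSU (n := Fin N)) J K hJK : GaugeField (F.P K) 0 (SU N) → GaugeField (F.P J) 0 (SU N)) =
      e ∘ Averaging.iter (fun i => BlockAveraging.blockAvg (P := F.P K) (j := i) (expMeanLogSU (n := Fin N))) (K - J) := rfl
  have hJac' : Measurable fun p => (Jac p : ℝ≥0∞) := hJac.coe_nnreal_ennreal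
  have hθ : Measurable fun p : GaugeField (F.P J) 0 (SU N) × GaugeField (F.P K) 0 (SU N) =>
      ((e' p.1, p.2) : GaugeField (F.P K) (K - J) (SU N) × GaugeField (F.P K) 0 (SU N)) := (he'.comp measurable_fst).prodMk measurable_snd
  set S' : Set (GaugeField (F.P J) 0 (SU N) × GaugeField (F.P K) 0 (SU N)) := {p | Φ (e' p.1, p.2) ∈ Hc} with hS'_def
  have hS'm : MeasurableSet S' := hHm.preimage (hΦ.comp hθ)
  have hne : ∀ V z, S'.indicator (fun p => Jac (e' p.1, p.2)) (V, z) ≠ 0 ↔ (∀ c, V (bondShift hs.symm c) ∈ T c z) ∧ Φ (e' V, z) ∈ Hc := by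
    intro V z
    constructor
    · intro h
      have hmem : (V, z) ∈ S' := Set.mem_of_indicator_ne_zero h
      refine ⟨(hJT (e' V) z).1 fun h0 => h ?_, hmem⟩
      rw [Set.indicator_of_mem hmem, h0]
    · rintro ⟨hV, hmem⟩
      have hmem' : (V, z) ∈ S' := hmem
      rw [Set.indicator_of_mem hmem']
      exact (hJT (e' V) z).2 hV
  have hcarrier : ∀ V, {z | S'.indicator (fun p => Jac (e' p.1, p.2)) (V, z) ≠ 0} =
      {z : GaugeField (F.P K) 0 (SU N) | (∀ c, (e' V) c ∈ T c z) ∧ Φ (e' V, z) ∈ Hc} := fun V => by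
    ext z
    rw [mem_setOf_eq, hne V z]
    rfl
  have hHle : Hc ⊆ {U | ∀ k, k < K - J → ∀ (c' : PBond (F.P K) (k + 1)) (i : Idx (F.P K)),
      dist1 (loopHol (Averaging.iter (fun i => BlockAveraging.blockAvg (P := F.P K) (j := i) (expMeanLogSU (n := Fin N))) k U) c' i) ≤ α} :=
    fun U hU k hk c' i => (hHlt hU k hk c' i).le
  refine ⟨fun p => Φ (e' p.1, p.2), S'.indicator fun p => Jac (e' p.1, p.2), fun c => bondShift hs.symm c, hΦ.comp hθ,
    (hJac.comp hθ).indicator hS'm, fun V z hj => ?_, fun V z hj => ((hne V z).1 hj).2, fun O hO hnull => ?law, hTc, hne,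
    fun V₀ z hint hfr => ?cont, fun V₀ z hout => ?dead, hTeq, fun V z hV => ?charted, fun p => ?bdd, fun V z g hg hH hd => ?recog,
    fun V => ?compact, fun V => ?contOn, hTbl, fun V z g => ?jbl, fun V z g hj => ?Φbl, fun V U hUV hUH => ?self, fun u hu V z => ?cov,
    fun V U hUV hUS => ?nhds⟩
  case nhds =>
    have hUH : U ∈ Hc := hSH hUS
    have hstrictU := hHlt hUH
    have h1 := hUV
    rw [hdesc, Function.comp_apply] at h1
    have hAU : Averaging.iter (fun i => BlockAveraging.blockAvg (P := F.P K) (j := i) (expMeanLogSU (n := Fin N))) (K - J) U = e' V := by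
      rw [← h1, he'e]
    have hG : {z : GaugeField (F.P K) 0 (SU N) | ∀ c, (e' V) c ∈ T c z} ∈ 𝓝 U := by
      have h := hgraph U hstrictU
      rwa [hAU] at h
    have hVU : ∀ c, (e' V) c ∈ T c U := fun c => by
      have h := mem_of_mem_nhds hG
      exact h c
    have hext : extend (iterCentralBond (K - J)) (fun c => U (iterCentralBond (K - J) c)) U = U := by
      funext b
      by_cases hb : ∃ c, iterCentralBond (K - J) c = b
      · obtain ⟨c, rfl⟩ := hb
        exact hβ.extend_apply _ _ _
      · exact extend_apply' _ _ _ hb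
    have hΦU : Φ (e' V, U) = U := by
      obtain ⟨-, hΦg⟩ := hrecog (e' V) U (fun c => U (iterCentralBond (K - J) c)) (hHsub hUH) (fun c => by rw [hext, hAU])
      rw [hΦg, hext]
    have hcw : ContinuousWithinAt (fun z : GaugeField (F.P K) 0 (SU N) => Φ (e' V, z))
        {z : GaugeField (F.P K) 0 (SU N) | ∀ c, (e' V) c ∈ T c z} U := by
      have ht := (htransfer (e' V) U hVU (by rw [hΦU]; exact hstrictU)).1
      exact ContinuousWithinAt.comp (f := fun z : GaugeField (F.P K) 0 (SU N) => ((e' V, z) : GaugeField (F.P K) (K - J) (SU N) × GaugeField (F.P K) 0 (SU N)))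
        (x := U) ht (continuous_const.prodMk continuous_id).continuousWithinAt fun z hz => hz
    have hpre : {z : GaugeField (F.P K) 0 (SU N) | Φ (e' V, z) ∈ Sfine} ∈ 𝓝[{z | ∀ c, (e' V) c ∈ T c z}] U :=
      hcw (hSo.mem_nhds (show (fun z : GaugeField (F.P K) 0 (SU N) => Φ (e' V, z)) U ∈ Sfine by simp only [hΦU]; exact hUS))
    obtain ⟨O₁, hO₁, hO₁sub⟩ := mem_nhdsWithin_iff_exists_mem_nhds_inter.1 hpre
    refine Filter.mem_of_superset (Filter.inter_mem hO₁ hG) fun z hz => ?_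
    show S'.indicator (fun p => Jac (e' p.1, p.2)) (V, z) ≠ 0
    exact (hne V z).2 ⟨hz.2, hSH (hO₁sub hz)⟩
  case cov =>
    have huinv : ∀ V' : GaugeField (F.P K) (K - J) (SU N),
        GaugeField.gaugeAct (transfUp (fun x => (u x)⁻¹ : GaugeTransf (F.P K) 0 (SU N)) (K - J)) V' = V' := fun V' => by
      have h := Summit.QuantumFields.YangMills.Theorems.FluctuationComparisonRegPrIntLS2BetaChartContCovariance.gaugeAct_inv_gaugeAct
        (transfUp u (K - J)) V'
      rw [hu V'] at h
      rw [Summit.QuantumFields.YangMills.Theorems.FluctuationComparisonRegPrIntLS2BetaChartContCovariance.transfUp_inv]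
      exact h
    have hlive_iff : Jac (e' V, GaugeField.gaugeAct u z) ≠ 0 ↔ Jac (e' V, z) ≠ 0 := by
      constructor
      · intro h
        have h' := (hcovΦ (fun x => (u x)⁻¹ : GaugeTransf (F.P K) 0 (SU N)) (e' V) (GaugeField.gaugeAct u z) h).1
        rwa [huinv, Summit.QuantumFields.YangMills.Theorems.FluctuationComparisonRegPrIntLS2BetaChartContCovariance.gaugeAct_inv_gaugeAct]
          at h'
      · intro h
        have h' := (hcovΦ u (e' V) z h).1
        rwa [hu] at h'
    have hΦcov : Jac (e' V, z) ≠ 0 → Φ (e' V, GaugeField.gaugeAct u z) = GaugeField.gaugeAct u (Φ (e' V, z)) := fun h => by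
      have h' := (hcovΦ u (e' V) z h).2
      rwa [hu] at h'
    refine ⟨?_, fun hj => hΦcov ((hJT (e' V) z).2 ((hne V z).1 hj).1)⟩
    by_cases hJ : Jac (e' V, z) ≠ 0
    · have hΦeq := hΦcov hJ
      by_cases hH : Φ (e' V, z) ∈ Hc
      · have hH' : ((V, GaugeField.gaugeAct u z) : GaugeField (F.P J) 0 (SU N) × GaugeField (F.P K) 0 (SU N)) ∈ S' := by
          show Φ (e' V, GaugeField.gaugeAct u z) ∈ Hc
          rw [hΦeq]; exact (hHg u _).2 hH
        rw [Set.indicator_of_mem hH' (fun p : GaugeField (F.P J) 0 (SU N) × GaugeField (F.P K) 0 (SU N) => Jac (e' p.1, p.2)),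
          Set.indicator_of_mem (show ((V, z) : GaugeField (F.P J) 0 (SU N) × GaugeField (F.P K) 0 (SU N)) ∈ S' from hH)
            (fun p : GaugeField (F.P J) 0 (SU N) × GaugeField (F.P K) 0 (SU N) => Jac (e' p.1, p.2))]
        have hJ' := hcovJ u (e' V) z hJ (hHlt hH)
        rw [hu] at hJ'
        exact hJ'
      · have hH' : ((V, GaugeField.gaugeAct u z) : GaugeField (F.P J) 0 (SU N) × GaugeField (F.P K) 0 (SU N)) ∉ S' := by
          show Φ (e' V, GaugeField.gaugeAct u z) ∉ Hc
          rw [hΦeq]; exact fun h => hH ((hHg u _).1 h)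
        rw [Set.indicator_of_notMem hH' (fun p : GaugeField (F.P J) 0 (SU N) × GaugeField (F.P K) 0 (SU N) => Jac (e' p.1, p.2)),
          Set.indicator_of_notMem (show ((V, z) : GaugeField (F.P J) 0 (SU N) × GaugeField (F.P K) 0 (SU N)) ∉ S' from hH)
            (fun p : GaugeField (F.P J) 0 (SU N) × GaugeField (F.P K) 0 (SU N) => Jac (e' p.1, p.2))]
    · rw [not_ne_iff] at hJ
      have hJ' : Jac (e' V, GaugeField.gaugeAct u z) = 0 := by
        by_contra h
        exact (hlive_iff.1 h) hJ
      have h1 : S'.indicator (fun p => Jac (e' p.1, p.2)) (V, GaugeField.gaugeAct u z) = 0 :=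
        Set.indicator_apply_eq_zero.2 fun _ => hJ'
      have h2 : S'.indicator (fun p => Jac (e' p.1, p.2)) (V, z) = 0 := Set.indicator_apply_eq_zero.2 fun _ => hJ
      exact h1.trans h2.symm
  case charted =>
    obtain ⟨hoff, hwin⟩ := hcharted (e' V) z hV
    refine ⟨hoff, hwin, ?_⟩
    have hJ : Jac (e' V, z) ≠ 0 := (hJT (e' V) z).2 hV
    rw [hdesc, Function.comp_apply, hfib _ _ hJ, hee']
  case bdd =>
    exact (mul_le_mul' le_rfl (Set.indicator_le_self _ _ p)).trans (hbdd (e' p.1, p.2))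
  case recog =>
    have h1 := hd
    rw [hdesc, Function.comp_apply] at h1
    have hiter : ∀ c, e' V c =
        Averaging.iter (fun i => BlockAveraging.blockAvg (P := F.P K) (j := i) (expMeanLogSU (n := Fin N))) (K - J)
          (extend (iterCentralBond (K - J)) g z) c := fun c => by
      rw [← h1, he'e]
    obtain ⟨hJ, hΦg⟩ := hrecog (e' V) z g hg hiter
    have hmemS' : (V, z) ∈ S' := by
      show Φ (e' V, z) ∈ Hc
      rw [hΦg]
      exact hH
    refine ⟨?_, hΦg⟩
    show S'.indicator (fun p => Jac (e' p.1, p.2)) (V, z) ≠ 0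
    rw [Set.indicator_of_mem hmemS']
    exact hJ
  case self =>
    have hext : extend (iterCentralBond (K - J)) (fun c => U (iterCentralBond (K - J) c)) U = U := by
      funext b
      by_cases hb : ∃ c, iterCentralBond (K - J) c = b
      · obtain ⟨c, rfl⟩ := hb
        exact hβ.extend_apply _ _ _
      · exact extend_apply' _ _ _ hb
    have hg : ∀ c, U (iterCentralBond (K - J) c) ∈ chainWindow (N := N) α (K - J) U c := hHsub hUH
    have h1 := hUV
    rw [hdesc, Function.comp_apply] at h1
    have hiter : ∀ c, e' V c =
        Averaging.iter (fun i => BlockAveraging.blockAvg (P := F.P K) (j := i) (expMeanLogSU (n := Fin N))) (K - J)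
          (extend (iterCentralBond (K - J)) (fun c => U (iterCentralBond (K - J) c)) U) c := fun c => by
      rw [hext, ← h1, he'e]
    obtain ⟨hJ, hΦg⟩ := hrecog (e' V) U (fun c => U (iterCentralBond (K - J) c)) hg hiter
    rw [hext] at hΦg
    have hmemS' : (V, U) ∈ S' := by
      show Φ (e' V, U) ∈ Hc
      rw [hΦg]
      exact hUH
    refine ⟨?_, hΦg⟩
    show S'.indicator (fun p => Jac (e' p.1, p.2)) (V, U) ≠ 0
    rw [Set.indicator_of_mem hmemS']
    exact hJ
  case compact =>
    rw [hcarrier V]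
    exact isCompact_carrier (P := F.P K) (N := N) hαδ hn hfib hJT hcharted hrecog hHcl hHle (e' V)
  case contOn =>
    obtain ⟨hΦc, hJc⟩ := continuousOn_carrier (P := F.P K) (N := N) (Jac := Jac) htransfer hHlt (e' V)
    rw [hcarrier V]
    refine ⟨hΦc, hJc.congr fun z hz => ?_⟩
    have hmem : (V, z) ∈ S' := hz.2
    exact Set.indicator_of_mem hmem (fun p : GaugeField (F.P J) 0 (SU N) × GaugeField (F.P K) 0 (SU N) => Jac (e' p.1, p.2))
  case jbl =>
    by_cases hV : ∀ c, (e' V) c ∈ T c z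
    · have hV' : ∀ c, (e' V) c ∈ T c (extend (iterCentralBond (K - J)) g z) := fun c => by rw [hTbl c z g]; exact hV c
      have hΦeq : Φ (e' V, extend (iterCentralBond (K - J)) g z) = Φ (e' V, z) := hΦbl (e' V) z g hV
      by_cases hH : Φ (e' V, z) ∈ Hc
      · have h1 : S'.indicator (fun p => Jac (e' p.1, p.2)) (V, extend (iterCentralBond (K - J)) g z) =
            Jac (e' V, extend (iterCentralBond (K - J)) g z) :=
          Set.indicator_of_mem (show ((V, extend (iterCentralBond (K - J)) g z) : GaugeField (F.P J) 0 (SU N) × GaugeField (F.P K) 0 (SU N)) ∈ S' from by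
            show Φ (e' V, extend (iterCentralBond (K - J)) g z) ∈ Hc
            rw [hΦeq]; exact hH) (fun p : GaugeField (F.P J) 0 (SU N) × GaugeField (F.P K) 0 (SU N) => Jac (e' p.1, p.2))
        have h2 : S'.indicator (fun p => Jac (e' p.1, p.2)) (V, z) = Jac (e' V, z) :=
          Set.indicator_of_mem (show ((V, z) : GaugeField (F.P J) 0 (SU N) × GaugeField (F.P K) 0 (SU N)) ∈ S' from hH) (fun p : GaugeField (F.P J) 0 (SU N) × GaugeField (F.P K) 0 (SU N) => Jac (e' p.1, p.2))
        exact h1.trans ((hJbl (e' V) z g).trans h2.symm)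
      · have h1 : S'.indicator (fun p => Jac (e' p.1, p.2)) (V, extend (iterCentralBond (K - J)) g z) = 0 :=
          Set.indicator_of_notMem (show ((V, extend (iterCentralBond (K - J)) g z) : GaugeField (F.P J) 0 (SU N) × GaugeField (F.P K) 0 (SU N)) ∉ S' from by
            show Φ (e' V, extend (iterCentralBond (K - J)) g z) ∉ Hc
            rw [hΦeq]; exact hH) (fun p : GaugeField (F.P J) 0 (SU N) × GaugeField (F.P K) 0 (SU N) => Jac (e' p.1, p.2))
        have h2 : S'.indicator (fun p => Jac (e' p.1, p.2)) (V, z) = 0 :=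
          Set.indicator_of_notMem (show ((V, z) : GaugeField (F.P J) 0 (SU N) × GaugeField (F.P K) 0 (SU N)) ∉ S' from hH) (fun p : GaugeField (F.P J) 0 (SU N) × GaugeField (F.P K) 0 (SU N) => Jac (e' p.1, p.2))
        exact h1.trans h2.symm
    · have hV' : ¬ ∀ c, (e' V) c ∈ T c (extend (iterCentralBond (K - J)) g z) := fun h => hV fun c => by
        rw [← hTbl c z g]; exact h c
      have h1 : S'.indicator (fun p => Jac (e' p.1, p.2)) (V, extend (iterCentralBond (K - J)) g z) = 0 := by
        by_contra h
        exact hV' ((hne V _).1 h).1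
      have h2 : S'.indicator (fun p => Jac (e' p.1, p.2)) (V, z) = 0 := by
        by_contra h
        exact hV ((hne V _).1 h).1
      exact h1.trans h2.symm
  case Φbl =>
    exact hΦbl (e' V) z g ((hne V z).1 hj).1
  · have hJ : Jac (e' V, z) ≠ 0 := (hJT (e' V) z).2 ((hne V z).1 hj).1
    rw [hdesc, Function.comp_apply, hfib _ _ hJ, hee']
  case law =>
    have hF5 := fibredLaw_transport (fieldMeasure (F.P K) 0 (SU N)) (fieldMeasure (F.P K) (K - J) (SU N)) (fieldMeasure (F.P J) 0 (SU N))
      he he' he'e hpres hΦ hJac' hlaw hSm (hSH.trans hHsub) hO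
    rw [hdesc, hF5]
    congr 1
    refine withDensity_congr_ae ?_
    have hmeas : MeasurableSet {p : GaugeField (F.P J) 0 (SU N) × GaugeField (F.P K) 0 (SU N) |
        Sfine.indicator 1 (Φ (e' p.1, p.2)) * (Jac (e' p.1, p.2) : ℝ≥0∞) = ((S'.indicator (fun p => Jac (e' p.1, p.2)) p : ℝ≥0) : ℝ≥0∞)} :=
      measurableSet_eq_fun ((((measurable_one.indicator hSm).comp (hΦ.comp hθ))).mul (hJac'.comp hθ))
        ((hJac.comp hθ).indicator hS'm).coe_nnreal_ennreal
    refine (Measure.ae_prod_iff_ae_ae hmeas).2 ?_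
    rw [ae_restrict_iff' hO]
    refine ae_of_all _ fun V hVO => ?_
    filter_upwards [hnull V hVO] with z hz
    show Sfine.indicator 1 (Φ (e' V, z)) * (Jac (e' V, z) : ℝ≥0∞) = ((S'.indicator (fun p => Jac (e' p.1, p.2)) (V, z) : ℝ≥0) : ℝ≥0∞)
    by_cases hj : S'.indicator (fun p => Jac (e' p.1, p.2)) (V, z) ≠ 0
    · have hSf : Φ (e' V, z) ∈ Sfine := hz hj
      have hmem : (V, z) ∈ S' := hSH hSf
      rw [Set.indicator_of_mem hSf, Set.indicator_of_mem hmem, Pi.one_apply, one_mul]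
    · rw [not_ne_iff] at hj
      rw [hj, ENNReal.coe_zero]
      by_cases hSf : Φ (e' V, z) ∈ Sfine
      · have hmem : (V, z) ∈ S' := hSH hSf
        have hJ0 : Jac (e' V, z) = 0 := by
          have h := hj
          rwa [Set.indicator_of_mem hmem] at h
        rw [hJ0, ENNReal.coe_zero, mul_zero]
      · rw [Set.indicator_of_notMem hSf, zero_mul]
  case cont =>
    obtain ⟨hΦat, hJat⟩ := hreg (e' V₀) z hint
    have hΦ'at : ContinuousAt (fun V : GaugeField (F.P J) 0 (SU N) => Φ (e' V, z)) V₀ :=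
      ContinuousAt.comp (f := e') (x := V₀) hΦat he'c.continuousAt
    have hJ'at : ContinuousAt (fun V : GaugeField (F.P J) 0 (SU N) => Jac (e' V, z)) V₀ :=
      ContinuousAt.comp (f := e') (x := V₀) hJat he'c.continuousAt
    refine ⟨hΦ'at, ?_⟩
    by_cases hi : Φ (e' V₀, z) ∈ interior Hc
    · have hev : ∀ᶠ V in 𝓝 V₀, (V, z) ∈ S' := by
        filter_upwards [hΦ'at.preimage_mem_nhds (mem_interior_iff_mem_nhds.1 hi)] with V hV
        exact hV
      refine hJ'at.congr ?_
      filter_upwards [hev] with V hV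
      exact (Set.indicator_of_mem hV (fun p : GaugeField (F.P J) 0 (SU N) × GaugeField (F.P K) 0 (SU N) => Jac (e' p.1, p.2))).symm
    · have hcl : Φ (e' V₀, z) ∉ closure Hc := fun h => hfr ⟨h, hi⟩
      have hev : ∀ᶠ V in 𝓝 V₀, (V, z) ∉ S' := by
        filter_upwards [hΦ'at.preimage_mem_nhds (isClosed_closure.isOpen_compl.mem_nhds hcl)] with V hV
        exact fun h => hV (subset_closure h)
      refine (continuousAt_const (y := (0 : ℝ≥0))).congr ?_
      filter_upwards [hev] with V hV
      exact (Set.indicator_of_notMem hV _).symm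
  case dead =>
    have hev : ∀ᶠ V in 𝓝 V₀, Jac (e' V, z) = 0 := he'c.continuousAt.eventually (hdead (e' V₀) z hout)
    filter_upwards [hev] with V hV
    exact Set.indicator_apply_eq_zero.2 fun _ => hV

end Summit.QuantumFields.YangMills.Theorems.FluctuationComparisonRegPrIntLS2BetaChartContDescend

end
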